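/-
Origin: expansion seat `prover-pub-hodgecm-mc-binder-1-g17-0`, handover #R119r2 2026-08-20T22:31:33Z md5 60604582fc9a (123 l.; REPLACE of HodgeCM/Model/LiuDictionaryTowerFixed.lean — PKG file now 670afbb19db1 (127 l., incl. packager Origin header); body of record 6e073b166656 (123 l.) → 60604582fc9a; owner binder-1 #R119 (RUN 64); token strike only; NAMES for audit: HodgeCM.Model.LiuDictionary.Thm418C_ofTower_iff · HodgeCM.Model.LiuDictionary.hIso_iff_families · HodgeCM.Model.LiuDictionary.mem_fixedBy_ofTower_iff) (`HOME/mc/pub-hodgecm-mc-binder-1-g17/campaign/new/LiuDictionaryTowerFixed.lean`, md5 60604582fc9a, 123 lines);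
landed by the gen-27 packager (p-g27) in gate run 65 REPLACES the earlier landed copy of `HodgeCM/Model/LiuDictionaryTowerFixed.lean` (verbatim).
-/
/-
Copyright (c) 2026 the pub-hodgecm formalisation cell (harness21).  New file, not vendored.
Origin: session prover-pub-hodgecm-mc-binder-1-g16-0 (unit pub-hodgecm-mc-binder-1-g16, BINDER PROVER gen 16 of lineage mc-binder-1;
content lane (J-Liu-Θ), (J3) HECKE-TOWER sub-leaf (T4)-strong, part 3: the READING of `hIso` / r8 `Thm418C` on the tower dictionary), 2026-08-20.
-/
import Summits.HodgeConjecture.HodgeCM.Model.LiuDictionaryTower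
import Summits.HodgeConjecture.HodgeCM.Model.TowerFixed

/-!
# What `fixedBy Γ.K H` and `Thm418C` say on `LiuDictionary.ofTower`

With `H := Tower` (#R109/#R113) and `fixedBy Γ.K (Tower) = levelImage Γ` (#R118):

* `LiuDictionary.mem_fixedBy_ofTower_iff` — `x ∈ fixedBy Γ.K (ofTower …).H ↔ ∃ c ∈ H_K, x = [c]` (a family of level-`K` classes
  over the components);
* `LiuDictionary.hIso_iff_families` — the junction's `hIso` triple at a tower level is EQUIVALENT to the (J4) family input;
* `LiuDictionary.Thm418C_ofTower_iff` — the cited combined reading r8 on `ofTower` asserts exactly: «for `ι₁ ∈ Φ_μ` there is `K₀` with: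
  for every `Γ ≤ K₀` below a conjugate of `K_f(3)` and every family `c ∈ H_K` whose class lies in the `μ`-block, the identity
  component `res c ∈ H¹(P_Γ; ℂ)` is in the `ℂ`-span of the CM classes `f^* α_d`, `d` admissible for `μ`» (levels not below a
  conjugate of `K_f(3)` carry `res Γ = 0` and say nothing).

Records: the universe's, `hA` ((ii-b)-free since the (iib-T) re-cut).
-/

noncomputable section

open Function Set
open NumberField
open Literature.AlgebraicGeometry.Motives
open Literature.AlgebraicGeometry.ShimuraVarieties
open Literature.AlgebraicGeometry.HodgeTheory
open Literature.NumberTheory.Automorphic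
open Literature.NumberTheory.Automorphic.PicardCM
open Literature.NumberTheory.Transcendental (Arapura2012_Cor_15_4_6)

namespace HodgeCM.Model

open HodgeCM.Model.TowerLevel HodgeCM.Model.TowerCarrier HodgeCM.Literature.Theta

variable (hHD : exists_isReal_hodgeModel) (hI : hodgePQ_independent_of_hodgeModel)
  (h₁ : BallQuotientUniformised) (h₃ : CMAbelianVarietyRealised) (hA : Arapura2012_Cor_15_4_6)
variable {L : CMField} {ι₁ : L →+* ℂ}

namespace LiuDictionary

variable {V : HermSpace3 L ι₁} (Char : Type) (Adm : Char → Type) (Ω : (μ : Char) → Adm μ → Type)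
    [∀ μ a, AddCommGroup (Ω μ a)] [∀ μ a, Module ℂ (Ω μ a)] [∀ μ a, Module (adelicAlgebra V) (Ω μ a)]
    [∀ μ a, IsScalarTower ℂ (adelicAlgebra V) (Ω μ a)] (PhiMu : Char → Prop) (adm : Char → LiuCMSide → Prop)

/-- **`fixedBy Γ.K H = H_K` on the tower dictionary**: the `Γ.K`-fixed vectors are exactly the classes of level-`K` families. -/
theorem mem_fixedBy_ofTower_iff {Γ : Level V} (hΓ : Γ.BelowConjThree)
    {x : (ofTower hHD hI h₁ h₃ hA V Char Adm Ω PhiMu adm).H} :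
    x ∈ fixedBy Γ.K (ofTower hHD hI h₁ h₃ hA V Char Adm Ω PhiMu adm).H ↔
      ∃ c : towerLevel hHD hI (ballQuotientUniformisedDatum_of h₁) h₃ hA Γ hΓ,
        ofLevel hHD hI (ballQuotientUniformisedDatum_of h₁) h₃ hA Γ hΓ c = x := by
  have e := fixedBy_eq_levelImage hHD hI (ballQuotientUniformisedDatum_of h₁) h₃ hA Γ hΓ
  change x ∈ fixedBy Γ.K (Tower hHD hI (ballQuotientUniformisedDatum_of h₁) h₃ hA V) ↔ _
  rw [e]
  rfl

/-- On `levelImage`, `res Γ` is the identity-component value of the family. -/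
theorem ofTower_res_ofLevel {Γ : Level V} (hΓ : Γ.BelowConjThree)
    (c : towerLevel hHD hI (ballQuotientUniformisedDatum_of h₁) h₃ hA Γ hΓ) :
    (ofTower hHD hI h₁ h₃ hA V Char Adm Ω PhiMu adm).res Γ (ofLevel hHD hI (ballQuotientUniformisedDatum_of h₁) h₃ hA Γ hΓ c) =
      TowerLevel.res hHD hI (ballQuotientUniformisedDatum_of h₁) h₃ hA c :=
  resTotal_ofLevel hHD hI (ballQuotientUniformisedDatum_of h₁) h₃ hA Γ hΓ c

/-- Off the tower's index set (`Γ` not below a conjugate of `K_f(3)`), `res Γ = 0`. -/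
theorem ofTower_res_of_not {Γ : Level V} (hΓ : ¬ Γ.BelowConjThree) :
    (ofTower hHD hI h₁ h₃ hA V Char Adm Ω PhiMu adm).res Γ = 0 := by
  change resTotal hHD hI (ballQuotientUniformisedDatum_of h₁) h₃ hA Γ = 0
  rw [resTotal, dif_neg hΓ]

/-- **The junction's `hIso` triple at a tower level is EQUIVALENT to the (J4) family input** (converse of `hIso_of_families`). -/
theorem hIso_iff_families {Γ : Level V} (hΓ : Γ.BelowConjThree)
    (ω : (picardCMUniverse hHD hI h₁ h₃).CohC ((picardCMUniverse hHD hI h₁ h₃).pms L ι₁ V Γ) 1)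
    (P : Submodule ℂ (ofTower hHD hI h₁ h₃ hA V Char Adm Ω PhiMu adm).H) :
    (∃ x : (ofTower hHD hI h₁ h₃ hA V Char Adm Ω PhiMu adm).H,
        x ∈ fixedBy Γ.K (ofTower hHD hI h₁ h₃ hA V Char Adm Ω PhiMu adm).H ∧
          (ofTower hHD hI h₁ h₃ hA V Char Adm Ω PhiMu adm).res Γ x = ω ∧ x ∈ P) ↔
      ∃ c : towerLevel hHD hI (ballQuotientUniformisedDatum_of h₁) h₃ hA Γ hΓ,
        TowerLevel.res hHD hI (ballQuotientUniformisedDatum_of h₁) h₃ hA c = ω ∧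
          (ofLevel hHD hI (ballQuotientUniformisedDatum_of h₁) h₃ hA Γ hΓ c :
              (ofTower hHD hI h₁ h₃ hA V Char Adm Ω PhiMu adm).H) ∈ P := by
  constructor
  · rintro ⟨x, hfix, hres, hP⟩
    obtain ⟨c, rfl⟩ := (mem_fixedBy_ofTower_iff hHD hI h₁ h₃ hA Char Adm Ω PhiMu adm hΓ).mp hfix
    exact ⟨c, (ofTower_res_ofLevel hHD hI h₁ h₃ hA Char Adm Ω PhiMu adm hΓ c).symm.trans hres, hP⟩
  · rintro ⟨c, hc, hP⟩
    exact hIso_of_towerLevel hHD hI h₁ h₃ hA Char Adm Ω PhiMu adm hΓ c hc P hP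

/-- **THE READING OF r8 `Thm418C` ON THE TOWER DICTIONARY.**  `(ofTower …).Thm418C` is equivalent to: for every `μ` with `ι₁ ∈ Φ_μ`
there is `K₀` such that for every `Γ ≤ K₀` below a conjugate of `K_f(3)` and every family `c ∈ H_K` with `[c] ∈ block μ`, the identity
component `res c` lies in `span_ℂ (cmClasses Γ μ)`. -/
theorem Thm418C_ofTower_iff :
    (ofTower hHD hI h₁ h₃ hA V Char Adm Ω PhiMu adm).Thm418C ↔
      ∀ μ : Char, PhiMu μ → ∃ K₀ : Level V, ∀ Γ ≤ K₀, ∀ (hΓ : Γ.BelowConjThree)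
        (c : towerLevel hHD hI (ballQuotientUniformisedDatum_of h₁) h₃ hA Γ hΓ),
        (ofLevel hHD hI (ballQuotientUniformisedDatum_of h₁) h₃ hA Γ hΓ c :
            (ofTower hHD hI h₁ h₃ hA V Char Adm Ω PhiMu adm).H) ∈
          (ofTower hHD hI h₁ h₃ hA V Char Adm Ω PhiMu adm).block μ →
        TowerLevel.res hHD hI (ballQuotientUniformisedDatum_of h₁) h₃ hA c ∈
          Submodule.span ℂ ((ofTower hHD hI h₁ h₃ hA V Char Adm Ω PhiMu adm).cmClasses Γ μ) := by
  change (∀ μ : Char, PhiMu μ → ∃ K₀ : Level V, ∀ Γ ≤ K₀,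
      ∀ x ∈ (ofTower hHD hI h₁ h₃ hA V Char Adm Ω PhiMu adm).block μ,
        x ∈ fixedBy Γ.K (ofTower hHD hI h₁ h₃ hA V Char Adm Ω PhiMu adm).H →
          (ofTower hHD hI h₁ h₃ hA V Char Adm Ω PhiMu adm).res Γ x ∈
            Submodule.span ℂ ((ofTower hHD hI h₁ h₃ hA V Char Adm Ω PhiMu adm).cmClasses Γ μ)) ↔ _
  refine forall₂_congr fun μ _ ↦ exists_congr fun K₀ ↦ forall₂_congr fun Γ _ ↦ ⟨fun h hΓ c hc ↦ ?_, fun h x hx hfix ↦ ?_⟩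
  · have h' := h _ hc (ofLevel_mem_fixedBy hHD hI h₁ h₃ hA Char Adm Ω PhiMu adm hΓ c)
    rwa [ofTower_res_ofLevel] at h'
  · by_cases hΓ : Γ.BelowConjThree
    · obtain ⟨c, rfl⟩ := (mem_fixedBy_ofTower_iff hHD hI h₁ h₃ hA Char Adm Ω PhiMu adm hΓ).mp hfix
      rw [ofTower_res_ofLevel]
      exact h hΓ c hx
    · rw [ofTower_res_of_not hHD hI h₁ h₃ hA Char Adm Ω PhiMu adm hΓ, LinearMap.zero_apply]
      exact Submodule.zero_mem _

end LiuDictionary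

end HodgeCM.Model

end
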